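import Literature.NumberTheory.Rogawski1990.KeysCaseTwoReducible
import HarnessLib

/-!
# N4 ★ `Rogawski1990.KeysCaseTwoReducible` UNFOLDED as a theorem

The booked letter N4 (#106) [Keys1984, §7 Thm. (2); Rogawski1990, §12.2 p. 173: at a non-split place the unitary principal series
`i_G(μ η₁ ‖·‖^{±1/2}, η₂)` of `U(Φ₃)(L⁺_v)` at a case-two character is reducible] is a `def … : Prop` whose body lives at the ≈ 10⁷-node
carrier type of `cmPrincipalSeries L 3 v χ`.  As for its sister letters (★ `U3PrincipalSeriesLettersUnfold` N2∕N3∕N5∕N5′, ★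
`U3PrincipalSeriesJacquetFiltrationFullUnfold` N1, ★ `U3PrincipalSeriesWeylConjugateUnfold` K1w), this file gives the THEOREM-WORLD BRIDGE
`KeysCaseTwoReducible_iff : KeysCaseTwoReducible L ↔ <body verbatim>`, so that a future in-house discharge ends with `(KeysCaseTwoReducible_iff L).2 …`
and consumers read the reducible subrepresentation in theorem-world.  Here `Iff.rfl` itself elaborates (31 s under `maxHeartbeats 4·10⁶`:
the carrier occurs once, in `Subrepresentation (…)`).  Theorems only; no definition, no named fact, no instance.

## References
[Keys1984] §7 Thm. (2) · [Rogawski1990] §12.2 p. 173 · [Casselman1995] §7.1.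
-/

set_option autoImplicit false
noncomputable section
open MeasureTheory NumberField IsDedekindDomain
open scoped MatrixGroups NNReal
namespace Literature.NumberTheory.Rogawski1990
open Literature.NumberTheory.Automorphic

variable (L : Type) [Field L] [NumberField L] [IsCMField L]

set_option maxHeartbeats 4000000 in  -- measured: `Iff.rfl` across the def boundary at the `cmPrincipalSeries` carrier, 31 s
/-- **N4 unfolded** (★ `KeysCaseTwoReducible`, verbatim body on the right): at every non-split `v`, the principal series of `U(Φ₃)(L⁺_v)` at a
case-two character `cmXiTorusChar L v μ η₁ η₂` (`μ` extending the quadratic character of `L_v⁄L⁺_v`, all characters continuous) has a proper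
non-zero subrepresentation. [cite: Keys1984, §7 Thm. (2)] [cite: Rogawski1990, §12.2 p. 173] -/
theorem KeysCaseTwoReducible_iff :
    KeysCaseTwoReducible L ↔
  ∀ (v : HeightOneSpectrum (𝓞 ↥(maximalRealSubfield L))),
    (∀ w : UnitaryGroup.PlacesOver L v, IsCMField.complexConj L • w.1 = w.1) →
    ∀ (μ : (UnitaryGroup.LocalRing L v)ˣ →* ℂˣ)
      (η₁ η₂ : ↥(UnitaryGroup.normOneUnits (UnitaryGroup.conjLocal L (IsCMField.complexConj L) v)) →* ℂˣ),
      UnitaryGroup.IsQuadraticCharExtension (UnitaryGroup.conjLocal L (IsCMField.complexConj L) v) μ →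
      Continuous (fun x => ((μ x : ℂˣ) : ℂ)) → Continuous (fun x => ((η₁ x : ℂˣ) : ℂ)) →
      Continuous (fun x => ((η₂ x : ℂˣ) : ℂ)) →
    ∃ N : Subrepresentation (UnitaryGroup.cmPrincipalSeries L 3 v (UnitaryGroup.cmXiTorusChar L v μ η₁ η₂)), N ≠ ⊥ ∧ N ≠ ⊤ := Iff.rfl

end Literature.NumberTheory.Rogawski1990
end
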